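import Summits.BirchSwinnertonDyer.BirchSwinnertonDyer.Theorems.ManinLocalTwoThreeStevensInfinityFibreRational
import Literature.NumberTheory.EllipticCurves.IsogenyFaltingsLFunctionProofs
import HarnessLib

/-!
# The `∞`-fibre cusp values of an ARBITRARY `X₁(N)`-parametrisation are rational points — es g41d's F-es-207 VERBATIM
(route `ManinLocalTwoThree`, crux C2 stmt-BirchSwinnertonDyer-22967; cell bsd-f2-manin, prover p2 gen 23; sequel of
`ManinLocalTwoThreeStevensInfinityFibreRational` (p767254), which did the case `D.c = 1`)

For EVERY `X₁(N)`-datum `D` of an elliptic `W/ℚ` (`π = D.uniformize`, multiplier `c_D = D.c`, any value) and every `γ = (a b; c δ) ∈ Γ₀(N)`: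
`σ(π(c_D·{∞, γ∞}_f)) = π(c_D·{∞, γ∞}_f)` for all `σ ∈ Aut(ℂ/ℚ)` (`map_uniformize_smul_cuspSymbol_eq_self`), hence `π(c_D·{∞, a/c}_f)` is the
base change of a RATIONAL point (`exists_ratPoint_eq_uniformize_smul_cuspSymbol`, `exists_ratPoint_eq_uniformize_smul_of_mem_periodLattice`), and
**F-es-207 `StevensInfinityFibreCuspRational` (HOME/es/g41/Sketch-es-g41d.lean §11) holds VERBATIM** (`stevensInfinityFibreCuspRational`; its
`IsOptimal` hypothesis is idle).

PROOF.  Reduction to Manin constant `1` by the STEVENS TWIN OF AN `X₁(N)`-DATUM (`exists_stevensTwin`, lattice-clause-free): the short model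
`W₁ : y² = x³ − g₂(Λ₁(f))/4·x − g₃(Λ₁(f))/4` over `ℚ` (rational invariants: `StevensCurve.ratCast_g₂_g₃_periodLatticeGamma1`; a period pair for
`Λ₁(f)` exists for every newform with rational coefficients — Shimura 7.14 in the tree, `IsNewform0.exists_periodPair_of_coeffField_eq_bot`, the one
line where p3's `StevensCurve.exists_stevensCurve` used the lattice clause, cf. es g41d `exists_stevensCurve_flat`) carries an OPTIMAL `X₁(N)`-datum
`D₁` with `D₁.f = D.f`, `D₁.c = 1`, `Λ(D₁.L) = Λ₁(f)`, and the lattice inclusion `c_D·Λ₁(f) ⊆ Λ_W` (`D.smul_periodLatticeGamma1_le`) is a `ℚ`-isogeny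
`ψ : W₁ → W` with `ψ_ℂ(π₁ z) = π(c_D z)` (`exists_isogeny_baseChange_apply_eq_of_forall_mul_mem_lattice`, Silverman VI.4.1).  Since `ψ_ℂ` commutes
with `Aut(ℂ/ℚ)` (`Isogeny.map_baseChange`, p2/p3's transport pattern) the `σ`-fixedness of `π₁({∞,γ∞}_f)` (p767254
`map_uniformize_cuspSymbol_eq_self`) transports to `π(c_D{∞,γ∞}_f)`; descent `Fix(Aut(ℂ/ℚ)) = ℚ` (`exists_ratPoint_of_forall_map_eq`) finishes.

HONEST FRAMING: unconditional and fact-free (no modularity, no CDT, no optimality); nothing about C2/C3, Manin's conjecture or BSD is proved here.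
No definitions, no sorry.  [cite: Stevens1982, §1.3 Thm. 1.3.1 (a), (b) (p. 13)] [cite: Stevens1989, §2 (1.4), (2.8)]
[cite: ConradEdixhovenStein2003, §6.1.2] [cite: SilvermanAEC2009, Thm. VI.4.1] [cite: Manin1972, Prop. 1.4 and Thm. 1.9]
-/

set_option autoImplicit false
-- lint-debt: the directory name repeats the summit name (sibling precedent `ManinLocalTwoThreeStevensInfinityFibreRational.lean`)
set_option linter.dupNamespace false

noncomputable section

open scoped MatrixGroups ModularForm Topology PeriodPair Manifold
open Complex Filter Function CongruenceSubgroup WeierstrassCurve Set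
open UpperHalfPlane hiding I
open Literature.NumberTheory.EllipticCurves Literature.NumberTheory.EllipticCurves.ModularForms
open Summit.BirchSwinnertonDyer.BirchSwinnertonDyer.Theorems.ManinLocalTwoThree.StevensCurve

namespace Summit.BirchSwinnertonDyer.BirchSwinnertonDyer.Theorems.ManinLocalTwoThree.CuspValues

variable {N : ℕ} [NeZero N]

/-! ## §1 The Stevens twin of an `X₁(N)`-datum (lattice-clause-free) -/

/-- **A period pair for `Λ₁(f)`, for the newform of ANY `X₁(N)`-datum** (no lattice clause): `Λ₀(f)` is spanned by a period pair for every newform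
with rational coefficients (Shimura 7.14, tree theorem `IsNewform0.exists_periodPair_of_coeffField_eq_bot` + `IsNewformOf.coeffField_eq_bot_of_isNewformOf`),
and `Λ₁(f)` then is too (`StevensCurve.exists_periodPair_periodLatticeGamma1`). [cite: ShimuraIATAF1971, Thm. 7.14] [cite: Stevens1989, §2] -/
theorem exists_periodPair_periodLatticeGamma1_of_gamma1Datum {W : WeierstrassCurve ℚ} [W.IsElliptic] (D : Gamma1ParametrizationData W N) :
    ∃ L₁ : PeriodPair, ∀ x, x ∈ L₁.lattice ↔ x ∈ periodLatticeGamma1 D.f := by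
  obtain ⟨L₀, hL₀⟩ := D.isNewformOf.1.exists_periodPair_of_coeffField_eq_bot D.isNewformOf.coeffField_eq_bot_of_isNewformOf
  refine exists_periodPair_periodLatticeGamma1 D.f L₀ fun x ↦ ?_
  rw [← hL₀]
  rfl

section Isogeny

variable [Algebra (AlgebraicClosure ℚ) ℂ] [IsScalarTower ℚ (AlgebraicClosure ℚ) ℂ]

/-- **The Stevens twin of an `X₁(N)`-datum.**  For every `X₁(N)`-datum `D` of an elliptic `W/ℚ` (any Manin multiplier `c_D`) there are an elliptic
`W₁/ℚ` (the short model on `Λ₁(f)`) with an OPTIMAL `X₁(N)`-datum `D₁`, `D₁.f = D.f`, `D₁.c = 1`, `Λ(D₁.L) = Λ₁(f)`, and a `ℚ`-isogeny `ψ : W₁ → W`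
with `ψ_ℂ(π₁ z) = π(c_D·z)` for all `z` (Silverman VI.4.1 on `c_D Λ₁(f) ⊆ Λ_W`).  p3's `StevensCurve.exists_stevensCurve` verbatim with the target an
`X₁(N)`-datum and the lattice clause replaced by Shimura 7.14 (cf. es g41d `exists_stevensCurve_flat`).
[cite: Stevens1989, §2] [cite: ConradEdixhovenStein2003, §6.1] [cite: SilvermanAEC2009, Thm. VI.4.1] -/
theorem exists_stevensTwin {W : WeierstrassCurve ℚ} [W.IsElliptic] (D : Gamma1ParametrizationData W N) :
    ∃ (W₁ : WeierstrassCurve ℚ) (_ : W₁.IsElliptic) (D₁ : Gamma1ParametrizationData W₁ N),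
      D₁.f = D.f ∧ D₁.c = 1 ∧ D₁.IsOptimal ∧ (∀ x, x ∈ D₁.L.lattice ↔ x ∈ periodLatticeGamma1 D.f) ∧
      ∃ ψ : WeierstrassCurve.Isogeny W₁ W, ∀ z : ℂ, ψ.baseChange (M := ℂ) (D₁.uniformize z) = D.uniformize ((D.c : ℂ) * z) := by
  classical
  have hf : D.f ≠ 0 := D.isNewformOf.1.ne_zero
  have hc₀ : D.c ≠ 0 := D.maninConstant_ne_zero
  have hrat : ∀ n, ∃ q : ℚ, (q : ℂ) = cuspCoeff D.f n := fun n ↦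
    ⟨(W.LFunction n : ℚ), by rw [D.isNewformOf.2 n, Rat.cast_intCast]⟩
  -- `Λ₁(f)` as a period pair with rational invariants; the short model `E`
  obtain ⟨L₁, hL₁⟩ := exists_periodPair_periodLatticeGamma1_of_gamma1Datum D
  obtain ⟨⟨q₂, hq₂⟩, ⟨q₃, hq₃⟩⟩ := ratCast_g₂_g₃_periodLatticeGamma1 D.f hf hrat L₁ hL₁
  set a₄ : ℚ := -q₂ / 4 with ha₄
  set a₆ : ℚ := -q₃ / 4 with ha₆
  have h₂ : L₁.g₂ = -4 * (a₄ : ℂ) := by rw [← hq₂, ha₄]; push_cast; ring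
  have h₃ : L₁.g₃ = -4 * (a₆ : ℂ) := by rw [← hq₃, ha₆]; push_cast; ring
  set E : WeierstrassCurve ℚ := { a₁ := 0, a₂ := 0, a₃ := 0, a₄ := a₄, a₆ := a₆ } with hE
  haveI hEe : E.IsElliptic := isElliptic_shortModel h₂ h₃
  have hEL : IsNeronLatticeOf (E.baseChange ℂ) L₁ := isNeronLatticeOf_shortModel h₂ h₃
  haveI : (E.baseChange ℂ).IsElliptic := by rw [WeierstrassCurve.baseChange]; infer_instance
  obtain ⟨u, hker, hsurj, hspec⟩ := IsNeronLatticeOf.exists_uniformize_holds hEL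
  -- the `ℚ`-isogeny `E → W` attached to `c_D Λ₁(f) ⊆ Λ_W`
  have hc₀Q : (D.c : ℚ) ≠ 0 := by exact_mod_cast hc₀
  have hle : ∀ z ∈ L₁.lattice, ((D.c : ℚ) : ℂ) * z ∈ D.L.lattice := fun z hz ↦ by
    rw [Rat.cast_intCast]
    exact D.smul_periodLatticeGamma1_le z ((hL₁ z).mp hz)
  obtain ⟨ψ, hψ, -, -⟩ := exists_isogeny_baseChange_apply_eq_of_forall_mul_mem_lattice hEL.1 hEL.2
    D.isNeronLattice.1 D.isNeronLattice.2 hker hsurj hspec D.ker_uniformize D.uniformize_spec hc₀Q hle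
  have hiso : WeierstrassCurve.IsIsogenous E W := ⟨ψ⟩
  have hnf : IsNewformOf E D.f := D.isNewformOf.of_isIsogenous hiso
  -- the degree of the `X₁(N)`-parametrisation `Γ₁(N)τ ↦ u(ℰ_f(τ))`
  have h1 : ∀ z ∈ periodLatticeGamma1 D.f, (1 : ℂ) * z ∈ L₁.lattice := fun z hz ↦ by
    rw [one_mul]; exact (hL₁ z).mpr hz
  obtain ⟨d, hd, hfin⟩ := FlatGamma1Datum.exists_gamma1_modularDegree hf (L := L₁) one_ne_zero h1
  have hker' : L₁.lattice.toAddSubgroup = u.ker :=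
    SetLike.coe_injective (by rw [Submodule.coe_toAddSubgroup, hker])
  let e : ℂ ⧸ L₁.lattice.toAddSubgroup ≃+ (E.baseChange ℂ).toAffine.Point :=
    QuotientAddGroup.liftEquiv L₁.lattice.toAddSubgroup hsurj hker'
  have he : ∀ x : ℂ, e.toEquiv (x : ℂ ⧸ L₁.lattice.toAddSubgroup) = u x := fun _ ↦ rfl
  have key := (FlatGamma1Datum.finite_setOf_natCard_gamma1FiberOrbits_ne_iff e.toEquiv
    (fun τ : ℍ ↦ (((1 : ℂ) * eichlerIntegral D.f τ : ℂ) : ℂ ⧸ L₁.lattice.toAddSubgroup)) d).mpr hfin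
  simp only [he] at key
  have key' : {P : (E.baseChange ℂ).toAffine.Point |
      Nat.card {y : Y1 N // ∃ τ : ℍ, Y1.mk N τ = y ∧ u ((((1 : ℤ) : ℂ)) * eichlerIntegral D.f τ) = P} ≠ d}.Finite := by
    rw [Int.cast_one]
    exact key
  refine ⟨E, hEe,
    { f := D.f
      isNewformOf := hnf
      L := L₁
      isNeronLattice := hEL
      uniformize := u
      ker_uniformize := hker
      uniformize_surjective := hsurj
      uniformize_spec := hspec
      c := 1
      smul_periodLatticeGamma1_le := fun z hz ↦ by rw [Int.cast_one, one_mul]; exact (hL₁ z).mpr hz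
      deg := d
      deg_pos := hd
      deg_spec := key' }, rfl, rfl, ?_, fun x ↦ hL₁ x, ψ, fun z ↦ ?_⟩
  · -- optimality: `Λ(L₁) = 1·Λ₁(f)`
    intro z hz
    exact ⟨z, (hL₁ z).mp hz, by push_cast; ring⟩
  · -- `ψ_ℂ(π₁ z) = π(c_D z)`
    have h := hψ z
    rw [Rat.cast_intCast] at h
    exact h

end Isogeny

/-! ## §2 `σ`-fixedness and rationality of the `∞`-fibre cusp values, any Manin multiplier -/

/-- **`σ(π(c_D·{∞, γ∞}_f)) = π(c_D·{∞, γ∞}_f)` for EVERY `X₁(N)`-datum**, every `γ ∈ Γ₀(N)` and every `σ ∈ Aut(ℂ/ℚ)`: the case `c = 1` (p767254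
`map_uniformize_cuspSymbol_eq_self`) on the Stevens twin, pushed through the `ℚ`-isogeny `ψ_ℂ(π₁ z) = π(c_D z)`, which commutes with `Aut(ℂ/ℚ)`.
[cite: Stevens1982, §1.3 Thm. 1.3.1 (b)] [cite: SilvermanAEC2009, Thm. VI.4.1] -/
theorem map_uniformize_smul_cuspSymbol_eq_self {W : WeierstrassCurve ℚ} [W.IsElliptic] (D : Gamma1ParametrizationData W N)
    (γ : Gamma0 N) (σ : ℂ ≃ₐ[ℚ] ℂ) :
    Affine.Point.map (W' := W) (σ : ℂ →ₐ[ℚ] ℂ) (D.uniformize ((D.c : ℂ) * cuspSymbol D.f γ)) =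
      D.uniformize ((D.c : ℂ) * cuspSymbol D.f γ) := by
  haveI : Algebra.IsAlgebraic ℚ (AlgebraicClosure ℚ) := AlgebraicClosure.isAlgebraic ℚ
  haveI : IsAlgClosure ℚ (AlgebraicClosure ℚ) := AlgebraicClosure.instIsAlgClosure ℚ
  haveI : Normal ℚ (AlgebraicClosure ℚ) := IsAlgClosure.normal ℚ (AlgebraicClosure ℚ)
  letI : Algebra (AlgebraicClosure ℚ) ℂ := (IsAlgClosed.lift : AlgebraicClosure ℚ →ₐ[ℚ] ℂ).toRingHom.toAlgebra
  haveI : IsScalarTower ℚ (AlgebraicClosure ℚ) ℂ := IsScalarTower.of_algebraMap_eq' (Subsingleton.elim _ _)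
  obtain ⟨W₁, hW₁, D₁, hf, hc₁, -, -, ψ, hψ⟩ := exists_stevensTwin D
  haveI := hW₁
  -- the case `c = 1` on the twin
  have hK := map_uniformize_cuspSymbol_eq_self D₁ hc₁ γ σ
  rw [hf] at hK
  -- Galois equivariance of `ψ_ℂ` (pattern of `StevensCurve.naturalTes75_of_modularity_slashConj`)
  set τ₀ : AlgebraicClosure ℚ ≃ₐ[ℚ] AlgebraicClosure ℚ := σ.restrictNormal (AlgebraicClosure ℚ) with hτ₀
  have hστ : ∀ a : AlgebraicClosure ℚ, (σ : ℂ →ₐ[ℚ] ℂ) (algebraMap (AlgebraicClosure ℚ) ℂ a) =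
      algebraMap (AlgebraicClosure ℚ) ℂ (Field.absoluteGaloisGroup.toAlgEquiv ℚ ((Field.absoluteGaloisGroup.toAlgEquiv ℚ).symm τ₀) a) := by
    intro a
    rw [MulEquiv.apply_symm_apply, hτ₀]
    exact (AlgEquiv.restrictNormal_commutes σ (AlgebraicClosure ℚ) a).symm
  have hequiv : ∀ P : (W₁.baseChange ℂ).toAffine.Point,
      Affine.Point.map (W' := W) (σ : ℂ →ₐ[ℚ] ℂ) (ψ.baseChange (M := ℂ) P) =
        ψ.baseChange (M := ℂ) (Affine.Point.map (W' := W₁) (σ : ℂ →ₐ[ℚ] ℂ) P) :=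
    fun P ↦ ψ.map_baseChange (σ : ℂ →ₐ[ℚ] ℂ) ((Field.absoluteGaloisGroup.toAlgEquiv ℚ).symm τ₀) hστ P
  -- push the fixedness through `ψ_ℂ`
  have hK' := congrArg (ψ.baseChange (M := ℂ)) hK
  rw [← hequiv, hψ] at hK'
  exact hK'

/-- **The `∞`-fibre cusp values of EVERY `X₁(N)`-datum are RATIONAL points**: for `γ ∈ Γ₀(N)`, `π(c_D·{∞, γ∞}_f) ∈ ι(W(ℚ))`.
[cite: Stevens1982, §1.3 Thm. 1.3.1 (a), (b)] [cite: ConradEdixhovenStein2003, §6.1.2] -/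
theorem exists_ratPoint_eq_uniformize_smul_cuspSymbol {W : WeierstrassCurve ℚ} [W.IsElliptic] (D : Gamma1ParametrizationData W N)
    (γ : Gamma0 N) :
    ∃ P : (W.baseChange ℚ).toAffine.Point,
      Affine.Point.baseChange (W' := W) ℚ ℂ P = D.uniformize ((D.c : ℂ) * cuspSymbol D.f γ) :=
  exists_ratPoint_of_forall_map_eq _ fun σ ↦ map_uniformize_smul_cuspSymbol_eq_self D γ σ

/-- **THEOREM K, constancy half, for EVERY `X₁(N)`-datum: `π(c_D·z) ∈ ι(W(ℚ))` for all `z ∈ Λ₀(f)`** (`Λ₀(f)` = the cusp-to-cusp periods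
`{∞, γ∞}_f`, `γ ∈ Γ₀(N)`). [cite: Stevens1982, §1.3 Thm. 1.3.1] [cite: Manin1972, Prop. 1.4 and Thm. 1.9] [cite: Stevens1989, §2] -/
theorem exists_ratPoint_eq_uniformize_smul_of_mem_periodLattice {W : WeierstrassCurve ℚ} [W.IsElliptic] (D : Gamma1ParametrizationData W N)
    (z : ℂ) (hz : z ∈ periodLattice D.f) :
    ∃ P : (W.baseChange ℚ).toAffine.Point, Affine.Point.baseChange (W' := W) ℚ ℂ P = D.uniformize ((D.c : ℂ) * z) := by
  have hz' : z ∈ (periodLattice D.f : Set ℂ) := hz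
  rw [coe_periodLattice_eq_range] at hz'
  obtain ⟨γ, rfl⟩ := hz'
  exact exists_ratPoint_eq_uniformize_smul_cuspSymbol D γ

/-- **F-es-207 `StevensInfinityFibreCuspRational` (es g41d, HOME/es/g41/Sketch-es-g41d.lean §11), VERBATIM, PROVED** — Stevens 1982 Thm. 1.3.1
(a)(b) at the `∞`-fibre: for an optimal `X₁(N)`-datum `D` of an elliptic `W/ℚ` and a cusp `a/c` with `c ≠ 0`, `N ∣ c`, `gcd(a, c) = 1`, the value
`π(c_D·{∞, a/c}_f)` is the base change of a `ℚ`-rational point of `W`.  (`IsOptimal` is not used.)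
[cite: Stevens1982, §1.3 Thm. 1.3.1 (a), (b) (p. 13)] [cite: ConradEdixhovenStein2003, §6.1.2] -/
theorem stevensInfinityFibreCuspRational :
    ∀ (W : WeierstrassCurve ℚ) [W.IsElliptic] {N : ℕ} [NeZero N] (D : Gamma1ParametrizationData W N),
      D.IsOptimal → ∀ a c : ℤ, c ≠ 0 → (N : ℤ) ∣ c → IsCoprime a c →
        ∃ P : (W.baseChange ℚ).toAffine.Point,
          WeierstrassCurve.Affine.Point.baseChange (W' := W) ℚ ℂ P = D.uniformize ((D.c : ℂ) * modularSymbol D.f ((a : ℚ) / (c : ℚ))) := by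
  intro W _ N _ D _ a c hc hNc hac
  obtain ⟨u, v, huv⟩ := hac
  set γ₀ : SL(2, ℤ) := ⟨!![a, -v; c, u], by rw [Matrix.det_fin_two_of]; linear_combination huv⟩ with hγ₀
  have hmem : γ₀ ∈ Gamma0 N := by
    rw [Gamma0_mem]
    simpa [hγ₀] using (ZMod.intCast_zmod_eq_zero_iff_dvd c N).mpr hNc
  obtain ⟨P, hP⟩ := exists_ratPoint_eq_uniformize_smul_cuspSymbol D ⟨γ₀, hmem⟩
  refine ⟨P, ?_⟩
  rw [hP, cuspSymbol]
  have h10 : ((⟨γ₀, hmem⟩ : Gamma0 N) : SL(2, ℤ)) 1 0 = c := by simp [hγ₀]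
  have h00 : ((⟨γ₀, hmem⟩ : Gamma0 N) : SL(2, ℤ)) 0 0 = a := by simp [hγ₀]
  rw [h10, h00, if_neg hc]

end Summit.BirchSwinnertonDyer.BirchSwinnertonDyer.Theorems.ManinLocalTwoThree.CuspValues

end
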